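import Summits.CriticalPhenomena.PercolationContinuityZ3.Theorems.PercNearOneGluingNoHeavyQuantFarSunSharpBoost
import HarnessLib

/-!
# FAR beyond trees: LEMMA 1 at EVERY layer with sharp constants — `Σ_{k<K} h k ≥ (9j+12)/2 ⇒ G_avg ≥ 1` (uniform in `j ≥ 2`, `K`-free)

builds on p205010 (kernel theorem, internal audit signed; external expert review pending)

Support file (`--supports stmt-CriticalPhenomena-4575`), seat `prim-cert-1` (gen 42); memo `prim-cert-1/FROM-prim-cert-1-g42-SHARP-LARGEK.md`.
The LEMMA 1 half of the sharpened all-layer large-`K` theorem (`…QuantFarSunSharpLargeK`: `SunFAR K j` for `j ≥ 2`, `K ≥ 17j + 68`), built on the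
sharp per-position bounds of `…QuantFarSunSharpBoost` (gen 41's `…QuantFarSunLargeK` needed `Σ ≥ 64·2^j`, `…LargeKLinear` `Σ ≥ 40j`, both with `jK < (Σ+1)²`):

* **`HairyCycle.witGavg_ge_one_sharp`** — LEMMA 1 with free parameters: `1 ≤ j ≤ M`, `θ₁, θ₂ ∈ (0,1]`, `0 < ρ ≤ 1 − e^{−(1−θ₂)M}/θ₂^{j−1}`,
  `N₀ := Σ − 2M − 2 − 2j > 0` and the single numeric hypothesis `e^{−(1−θ₁)(Σ−1)}/θ₁^{2j} · (Σ − (2j−1)ρ) ≤ N₀·ρ³` give `witGavg K h j ≥ 1`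
  for `0 < h ≤ 1` on `range K` — for EVERY `K` (charging criterion `witGavg_ge_one_of_charging` with unit weights on the `M`-central positions:
  cover by `card_central_gt_gen`, comparison by `boost_ge_sharp` and `noWit_erase_le_chernoff`);
* numeric lemmas `exp_five_twelfths_ge`, `exp_three_quarters_ge`, `exp_nine_quarters_ge`, `exp_five_halves_ge` (quadratic Taylor bound and `e > 2.718281828`),
  `rho_half_le` (`2(3/2)^{j−1} ≤ e^{(5j+4)/12}`), `four_pow_poly_le_nine_pow` (induction), **`sharp_numeric`** (the numeric hypothesis for
  `M = (5j+4)/4`, `θ₂ = 2/3`, `θ₁ = ρ = 1/2`, all `j ≥ 2`, `Σ ≥ (9j+12)/2`);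
* **`HairyCycle.witGavg_ge_one_of_sum_ge_all`** — for `j ≥ 2`, `0 < h ≤ 1` on `range K` and `Σ_{k<K} h k ≥ (9j+12)/2`: `witGavg K h j ≥ 1`.
No definitions, no sorries, standard axioms.  [this work]
-/

noncomputable section

namespace Summit.CriticalPhenomena.PercolationContinuityZ3.Theorems.HairyCycle

open Finset
open scoped Classical

variable {K : ℕ}

/-! ## LEMMA 1 with free parameters -/

/-- **LEMMA 1 at layer `j ≥ 1`, sharp form with free parameters.**  Let `0 < h ≤ 1` on `range K`, `Σ = Σ_{k<K} h k`, reals `M ≥ j`,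
`θ₁, θ₂ ∈ (0,1]`, `0 < ρ ≤ 1 − e^{−(1−θ₂)M}/θ₂^{j−1}`, `N₀ := Σ − 2M − 2 − 2j > 0`, and assume the numeric inequality
`e^{−(1−θ₁)(Σ−1)}/θ₁^{2j}·(Σ − (2j−1)ρ) ≤ N₀ ρ³`.  Then `witGavg K h j ≥ 1`. [this work] -/
theorem witGavg_ge_one_sharp {h : ℕ → ℝ} (hh : ∀ k, k < K → 0 < h k ∧ h k ≤ 1) {j : ℕ} (hj : 1 ≤ j)
    {M θ₁ θ₂ ρ : ℝ} (hMj : (j : ℝ) ≤ M) (hθ₁0 : 0 < θ₁) (hθ₁1 : θ₁ ≤ 1) (hθ₂0 : 0 < θ₂) (hθ₂1 : θ₂ ≤ 1)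
    (hρ0 : 0 < ρ) (hρ : ρ ≤ 1 - Real.exp (-(1 - θ₂) * M) / θ₂ ^ (j - 1))
    (hN : 0 < ∑ k ∈ range K, h k - 2 * M - 2 - 2 * j)
    (hnum : Real.exp (-(1 - θ₁) * (∑ k ∈ range K, h k - 1)) / θ₁ ^ (2 * j) * (∑ k ∈ range K, h k - (2 * j - 1) * ρ) ≤
      (∑ k ∈ range K, h k - 2 * M - 2 - 2 * j) * ρ ^ 3) :
    1 ≤ witGavg K h j := by
  have hh' : ∀ k, k < K → 0 ≤ h k ∧ h k ≤ 1 := fun k hk => ⟨(hh k hk).1.le, (hh k hk).2⟩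
  set S := ∑ k ∈ range K, h k with hSdef
  set N₀ := S - 2 * M - 2 - 2 * j with hN₀def
  set P := Real.exp (-(1 - θ₁) * (S - 1)) / θ₁ ^ (2 * j) with hPdef
  have hj' : (1 : ℝ) ≤ j := by exact_mod_cast hj
  have hM0 : 0 ≤ M := le_trans (by linarith) hMj
  have hρ1 : ρ ≤ 1 := by
    have : 0 ≤ Real.exp (-(1 - θ₂) * M) / θ₂ ^ (j - 1) := div_nonneg (Real.exp_pos _).le (pow_nonneg hθ₂0.le _)
    linarith
  have hden : 0 < S - (2 * j - 1) * ρ := by nlinarith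
  have hP0 : 0 ≤ P := div_nonneg (Real.exp_pos _).le (pow_nonneg hθ₁0.le _)
  -- central positions (threshold `M`)
  set Cen := (range K).filter (fun k => M ≤ ∑ i ∈ range k, h i ∧ M ≤ ∑ i ∈ (range K).filter (fun i => k < i), h i) with hCendef
  have hCen := card_central_gt_gen hh' (M := M) hM0
  rw [← hSdef, ← hCendef] at hCen
  refine witGavg_ge_one_of_charging hh j (fun k => if k ∈ Cen then 1 else 0) hN (fun H hH hne => ?_) (fun k hk => ?_)
  · -- cover: `N₀ ≤ #(Cen ∖ H)`
    have hHc : H.card ≤ 2 * j := card_le_of_wit_not_nonempty hne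
    have hsum : ∑ k ∈ range K \ H, (if k ∈ Cen then (1 : ℝ) else 0) = (((range K \ H).filter (fun k => k ∈ Cen)).card : ℝ) := by
      rw [Finset.sum_boole]
    rw [hsum]
    have hsub : Cen \ H ⊆ (range K \ H).filter (fun k => k ∈ Cen) := by
      intro k hk
      rw [Finset.mem_sdiff] at hk
      exact Finset.mem_filter.2 ⟨Finset.mem_sdiff.2 ⟨(Finset.mem_filter.1 hk.1).1, hk.2⟩, hk.1⟩
    have hc1 : ((Cen \ H).card : ℝ) ≤ (((range K \ H).filter (fun k => k ∈ Cen)).card : ℝ) := by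
      exact_mod_cast Finset.card_le_card hsub
    have hc2 : (Cen.card : ℝ) - 2 * j ≤ ((Cen \ H).card : ℝ) := by
      have h' : Cen.card - H.card ≤ (Cen \ H).card := Finset.le_card_sdiff H Cen
      have h2j : (H.card : ℝ) ≤ 2 * j := by exact_mod_cast hHc
      have : (Cen.card : ℝ) - (H.card : ℝ) ≤ ((Cen.card - H.card : ℕ) : ℝ) := by
        rcases le_or_gt H.card Cen.card with hle | hgt
        · rw [Nat.cast_sub hle]
        · rw [Nat.sub_eq_zero_of_le hgt.le]; push_cast; linarith [(Nat.cast_lt (α := ℝ)).2 hgt]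
      have h'' : ((Cen.card - H.card : ℕ) : ℝ) ≤ ((Cen \ H).card : ℝ) := by exact_mod_cast h'
      linarith
    change S - 2 * M - 2 - 2 * j ≤ _
    linarith
  · -- comparison: `ω_k d_k ≤ N₀ · a_k`
    have ha0 : 0 ≤ ∑ Q ∈ ((range K).erase k).powerset, hairW K h Q * witAvgKernel j (insert k Q) k :=
      Finset.sum_nonneg fun Q _ => mul_nonneg (hairW_nonneg hh' Q) (by
        unfold witAvgKernel; split_ifs
        · exact div_nonneg zero_le_one (Nat.cast_nonneg _)
        · exact le_rfl)
    by_cases hkC : k ∈ Cen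
    · rw [if_pos hkC, one_mul]
      have hkC' := hkC
      rw [hCendef, Finset.mem_filter] at hkC'
      -- `d_k = (1 − h k)·D⁰_k`, `D⁰_k ≤ P`
      have hd : ∑ Q ∈ ((range K).erase k).powerset, hairW K h Q * (if (wit j Q).Nonempty then (0 : ℝ) else 1) =
          (1 - h k) * ∑ Q ∈ ((range K).erase k).powerset, hairW K (Function.update h k 0) Q * (if (wit j Q).Nonempty then (0 : ℝ) else 1) := by
        rw [Finset.mul_sum]
        refine Finset.sum_congr rfl fun Q hQ => ?_
        rw [Finset.mem_powerset] at hQ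
        rw [hairW_eq_mul_erase h hk (fun hm => Finset.notMem_erase k _ (hQ hm))]
        ring
      have hD := noWit_erase_le_chernoff hh' j hk hθ₁0 hθ₁1
      rw [← hSdef] at hD
      have hDP : ∑ Q ∈ ((range K).erase k).powerset, hairW K (Function.update h k 0) Q * (if (wit j Q).Nonempty then (0 : ℝ) else 1) ≤ P := by
        refine hD.trans ?_
        rw [hPdef]
        apply div_le_div_of_nonneg_right _ (pow_pos hθ₁0 _).le
        apply Real.exp_le_exp.2
        have h1 : S - 1 ≤ S - h k := by linarith [(hh k hk).2]
        have h2 : 0 ≤ 1 - θ₁ := by linarith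
        nlinarith
      -- `a_k ≥ (1 − h k) ρ³/(S − (2j−1)ρ)`
      have ha := boost_ge_sharp hh' hj hk hMj hθ₂0 hθ₂1 hρ0 hρ hkC'.2.1 hkC'.2.2
      rw [← hSdef] at ha
      have hu : 0 ≤ 1 - h k := by linarith [(hh k hk).2]
      -- `P ≤ N₀ ρ³/(S − (2j−1)ρ)`
      have hPN : P ≤ N₀ * ρ ^ 3 / (S - (2 * j - 1) * ρ) := by
        rw [le_div_iff₀ hden]; exact hnum
      rw [hd]
      calc (1 - h k) * ∑ Q ∈ ((range K).erase k).powerset,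
            hairW K (Function.update h k 0) Q * (if (wit j Q).Nonempty then (0 : ℝ) else 1)
          ≤ (1 - h k) * P := mul_le_mul_of_nonneg_left hDP hu
        _ ≤ (1 - h k) * (N₀ * ρ ^ 3 / (S - (2 * j - 1) * ρ)) := mul_le_mul_of_nonneg_left hPN hu
        _ = N₀ * ((1 - h k) * ρ ^ 3 / (S - (2 * j - 1) * ρ)) := by ring
        _ ≤ N₀ * ∑ Q ∈ ((range K).erase k).powerset, hairW K h Q * witAvgKernel j (insert k Q) k :=
            mul_le_mul_of_nonneg_left ha hN.le
    · rw [if_neg hkC, zero_mul]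
      exact mul_nonneg hN.le ha0

/-! ## Numeric lemmas for the uniform instance `M = (5j+4)/4`, `θ₂ = 2/3`, `θ₁ = ρ = 1/2` -/

/-- `e^{5/12} ≥ 3/2`. [folklore] -/
theorem exp_five_twelfths_ge : (3 / 2 : ℝ) ≤ Real.exp (5 / 12) := by
  have := Real.quadratic_le_exp_of_nonneg (show (0 : ℝ) ≤ 5 / 12 by norm_num)
  nlinarith

/-- `e^{3/4} ≥ 2`. [folklore] -/
theorem exp_three_quarters_ge : (2 : ℝ) ≤ Real.exp (3 / 4) := by
  have := Real.quadratic_le_exp_of_nonneg (show (0 : ℝ) ≤ 3 / 4 by norm_num)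
  nlinarith

/-- `e^{9/4} ≥ 9`. [folklore] -/
theorem exp_nine_quarters_ge : (9 : ℝ) ≤ Real.exp (9 / 4) := by
  have h1 := Real.exp_one_gt_d9
  have h2 := Real.quadratic_le_exp_of_nonneg (show (0 : ℝ) ≤ 1 / 4 by norm_num)
  have e : Real.exp (9 / 4) = Real.exp 1 ^ 2 * Real.exp (1 / 4) := by
    rw [← Real.exp_nat_mul, ← Real.exp_add]; norm_num
  rw [e]
  have h3 : (2.7182818283 : ℝ) ^ 2 ≤ Real.exp 1 ^ 2 := pow_le_pow_left₀ (by norm_num) h1.le 2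
  have h4 : (0 : ℝ) ≤ Real.exp (1 / 4) := (Real.exp_pos _).le
  nlinarith

/-- `e^{5/2} ≥ 12`. [folklore] -/
theorem exp_five_halves_ge : (12 : ℝ) ≤ Real.exp (5 / 2) := by
  have h1 := Real.exp_one_gt_d9
  have h2 := Real.quadratic_le_exp_of_nonneg (show (0 : ℝ) ≤ 1 / 2 by norm_num)
  have e : Real.exp (5 / 2) = Real.exp 1 ^ 2 * Real.exp (1 / 2) := by
    rw [← Real.exp_nat_mul, ← Real.exp_add]; norm_num
  rw [e]
  have h3 : (2.7182818283 : ℝ) ^ 2 ≤ Real.exp 1 ^ 2 := pow_le_pow_left₀ (by norm_num) h1.le 2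
  have h4 : (0 : ℝ) ≤ Real.exp (1 / 2) := (Real.exp_pos _).le
  nlinarith

/-- The flank reliability of the uniform instance: `1/2 ≤ 1 − e^{−(1 − 2/3)·(5j+4)/4}/(2/3)^{j−1}` (`j ≥ 1`), i.e.
`2·(3/2)^{j−1} ≤ e^{(5j+4)/12} = (e^{5/12})^{j−1}·e^{3/4}`. [this work] -/
theorem rho_half_le {j : ℕ} (hj : 1 ≤ j) :
    (1 / 2 : ℝ) ≤ 1 - Real.exp (-(1 - 2 / 3) * ((5 * j + 4) / 4)) / (2 / 3 : ℝ) ^ (j - 1) := by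
  obtain ⟨c, rfl⟩ : ∃ c, j = c + 1 := ⟨j - 1, by omega⟩
  rw [Nat.add_sub_cancel]
  -- `e^{(5c+9)/12} ≥ (3/2)^c · 2`
  have hexp : (3 / 2 : ℝ) ^ c * 2 ≤ Real.exp ((1 - 2 / 3) * ((5 * ((c + 1 : ℕ) : ℝ) + 4) / 4)) := by
    have e : (1 - 2 / 3 : ℝ) * ((5 * ((c + 1 : ℕ) : ℝ) + 4) / 4) = (c : ℝ) * (5 / 12) + 3 / 4 := by push_cast; ring
    rw [e, Real.exp_add, Real.exp_nat_mul]
    exact mul_le_mul (pow_le_pow_left₀ (by norm_num) exp_five_twelfths_ge c) exp_three_quarters_ge (by norm_num)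
      (pow_nonneg (Real.exp_pos _).le c)
  have hpos : 0 < Real.exp ((1 - 2 / 3) * ((5 * ((c + 1 : ℕ) : ℝ) + 4) / 4)) := Real.exp_pos _
  have hq : (0 : ℝ) < (2 / 3 : ℝ) ^ c := pow_pos (by norm_num) c
  -- `e^{−x}/(2/3)^c ≤ 1/2`
  have hkey : Real.exp (-(1 - 2 / 3) * ((5 * ((c + 1 : ℕ) : ℝ) + 4) / 4)) / (2 / 3 : ℝ) ^ c ≤ 1 / 2 := by
    rw [div_le_iff₀ hq, show -(1 - 2 / 3 : ℝ) * ((5 * ((c + 1 : ℕ) : ℝ) + 4) / 4) = -((1 - 2 / 3) * ((5 * ((c + 1 : ℕ) : ℝ) + 4) / 4)) by ring,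
      Real.exp_neg, inv_le_iff_one_le_mul₀ hpos]
    have e2 : (3 / 2 : ℝ) ^ c * (2 / 3 : ℝ) ^ c = 1 := by rw [← mul_pow]; norm_num
    calc (1 : ℝ) = ((3 / 2 : ℝ) ^ c * 2) * (1 / 2 * (2 / 3 : ℝ) ^ c) := by nlinarith [e2]
      _ ≤ Real.exp ((1 - 2 / 3) * ((5 * ((c + 1 : ℕ) : ℝ) + 4) / 4)) * (1 / 2 * (2 / 3 : ℝ) ^ c) :=
          mul_le_mul_of_nonneg_right hexp (by positivity)
      _ = 1 / 2 * (2 / 3 : ℝ) ^ c * Real.exp ((1 - 2 / 3) * ((5 * ((c + 1 : ℕ) : ℝ) + 4) / 4)) := by ring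
  linarith

/-- The induction behind `sharp_numeric`: `4^{n+2}·(7n + 27) ≤ 6·9^{n+2}`. [this work] -/
theorem four_pow_poly_le_nine_pow (n : ℕ) : (4 : ℝ) ^ (n + 2) * (7 * n + 27) ≤ 6 * 9 ^ (n + 2) := by
  induction n with
  | zero => norm_num
  | succ n ih =>
    have h4 : (0 : ℝ) ≤ (4 : ℝ) ^ (n + 2) := by positivity
    have e4 : (4 : ℝ) ^ (n + 1 + 2) = 4 ^ (n + 2) * 4 := by rw [show n + 1 + 2 = n + 2 + 1 by ring, pow_succ]
    have e9 : (9 : ℝ) ^ (n + 1 + 2) = 9 ^ (n + 2) * 9 := by rw [show n + 1 + 2 = n + 2 + 1 by ring, pow_succ]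
    rw [e4, e9]
    push_cast
    nlinarith

/-- **Numeric core of the uniform LEMMA 1**: for `j ≥ 2` and `S ≥ (9j+12)/2`,
`e^{−(1 − 1/2)(S−1)}/(1/2)^{2j} · (S − (2j−1)·(1/2)) ≤ (S − 2·((5j+4)/4) − 2 − 2j)·(1/2)³`. [this work] -/
theorem sharp_numeric {j : ℕ} (hj : 2 ≤ j) {S : ℝ} (hS : (9 * (j : ℝ) + 12) / 2 ≤ S) :
    Real.exp (-(1 - 1 / 2) * (S - 1)) / (1 / 2 : ℝ) ^ (2 * j) * (S - (2 * j - 1) * (1 / 2)) ≤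
      (S - 2 * ((5 * j + 4) / 4) - 2 - 2 * j) * (1 / 2 : ℝ) ^ 3 := by
  obtain ⟨n, rfl⟩ : ∃ n, j = n + 2 := ⟨j - 2, by omega⟩
  set u := S - (9 * ((n + 2 : ℕ) : ℝ) + 12) / 2 with hu
  have hu0 : 0 ≤ u := by rw [hu]; linarith
  -- the exponential: `e^{(S−1)/2} ≥ 9^{n+2} · 12 · (1 + u/2)`
  have hE : (9 : ℝ) ^ (n + 2) * 12 * (1 + u / 2) ≤ Real.exp ((1 - 1 / 2) * (S - 1)) := by
    have e : (1 - 1 / 2 : ℝ) * (S - 1) = ((n + 2 : ℕ) : ℝ) * (9 / 4) + 5 / 2 + u / 2 := by rw [hu]; push_cast; ring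
    rw [e, Real.exp_add, Real.exp_add, Real.exp_nat_mul]
    have h1 : (9 : ℝ) ^ (n + 2) ≤ Real.exp (9 / 4) ^ (n + 2) := pow_le_pow_left₀ (by norm_num) exp_nine_quarters_ge _
    have h2 := exp_five_halves_ge
    have h3 : 1 + u / 2 ≤ Real.exp (u / 2) := by linarith [Real.add_one_le_exp (u / 2)]
    have h12 : (9 : ℝ) ^ (n + 2) * 12 ≤ Real.exp (9 / 4) ^ (n + 2) * Real.exp (5 / 2) :=
      mul_le_mul h1 h2 (by norm_num) (pow_nonneg (Real.exp_pos _).le _)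
    exact mul_le_mul h12 h3 (by linarith) (mul_nonneg (pow_nonneg (Real.exp_pos _).le _) (Real.exp_pos _).le)
  have hEpos : 0 < Real.exp ((1 - 1 / 2) * (S - 1)) := Real.exp_pos _
  -- rewrite the left side as `4^{n+2} (S − j + 1/2) / e^{(S−1)/2}`
  have e1 : (1 / 2 : ℝ) ^ (2 * (n + 2)) = 1 / 4 ^ (n + 2) := by
    rw [pow_mul, show ((1 : ℝ) / 2) ^ 2 = 1 / 4 by norm_num, one_div_pow]
  have e2 : Real.exp (-(1 - 1 / 2) * (S - 1)) = 1 / Real.exp ((1 - 1 / 2) * (S - 1)) := by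
    rw [show -(1 - 1 / 2 : ℝ) * (S - 1) = -((1 - 1 / 2) * (S - 1)) by ring, Real.exp_neg, inv_eq_one_div]
  rw [e1, e2]
  rw [show (1 : ℝ) / Real.exp ((1 - 1 / 2) * (S - 1)) / (1 / 4 ^ (n + 2)) * (S - (2 * ((n + 2 : ℕ) : ℝ) - 1) * (1 / 2)) =
      (4 : ℝ) ^ (n + 2) * (S - (2 * ((n + 2 : ℕ) : ℝ) - 1) * (1 / 2)) / Real.exp ((1 - 1 / 2) * (S - 1)) by
    field_simp]
  rw [div_le_iff₀ hEpos]
  -- polynomial inequality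
  have hpoly := four_pow_poly_le_nine_pow n
  have h4 : (0 : ℝ) ≤ (4 : ℝ) ^ (n + 2) := by positivity
  have h9 : (0 : ℝ) ≤ (9 : ℝ) ^ (n + 2) := by positivity
  have hS' : S = (9 * ((n + 2 : ℕ) : ℝ) + 12) / 2 + u := by rw [hu]; ring
  have hrhs0 : 0 ≤ (S - 2 * ((5 * ((n + 2 : ℕ) : ℝ) + 4) / 4) - 2 - 2 * ((n + 2 : ℕ) : ℝ)) * (1 / 2 : ℝ) ^ 3 := by
    rw [hS']; push_cast; nlinarith
  calc (4 : ℝ) ^ (n + 2) * (S - (2 * ((n + 2 : ℕ) : ℝ) - 1) * (1 / 2))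
      ≤ (S - 2 * ((5 * ((n + 2 : ℕ) : ℝ) + 4) / 4) - 2 - 2 * ((n + 2 : ℕ) : ℝ)) * (1 / 2 : ℝ) ^ 3 * ((9 : ℝ) ^ (n + 2) * 12 * (1 + u / 2)) := by
        rw [hS']; push_cast
        nlinarith [mul_nonneg h4 hu0, mul_nonneg h9 hu0, mul_nonneg (mul_nonneg h9 hu0) hu0]
    _ ≤ (S - 2 * ((5 * ((n + 2 : ℕ) : ℝ) + 4) / 4) - 2 - 2 * ((n + 2 : ℕ) : ℝ)) * (1 / 2 : ℝ) ^ 3 * Real.exp ((1 - 1 / 2) * (S - 1)) :=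
        mul_le_mul_of_nonneg_left hE hrhs0

/-! ## LEMMA 1, uniform in the layer -/

/-- **LEMMA 1 (every layer, uniform constants).**  If `j ≥ 2`, `0 < h k ≤ 1` for `k < K` and `Σ_{k<K} h k ≥ (9j+12)/2`, then
`witGavg K h j ≥ 1` — for every `K`. [this work] -/
theorem witGavg_ge_one_of_sum_ge_all {h : ℕ → ℝ} (hh : ∀ k, k < K → 0 < h k ∧ h k ≤ 1) {j : ℕ} (hj : 2 ≤ j)
    (hS : (9 * (j : ℝ) + 12) / 2 ≤ ∑ k ∈ range K, h k) : 1 ≤ witGavg K h j := by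
  have hj1 : 1 ≤ j := le_trans (by norm_num) hj
  have hj' : (2 : ℝ) ≤ j := by exact_mod_cast hj
  refine witGavg_ge_one_sharp hh hj1 (M := (5 * j + 4) / 4) (θ₁ := 1 / 2) (θ₂ := 2 / 3) (ρ := 1 / 2)
    (by linarith) (by norm_num) (by norm_num) (by norm_num) (by norm_num) (by norm_num) (rho_half_le hj1) (by linarith) ?_
  exact sharp_numeric hj hS

end Summit.CriticalPhenomena.PercolationContinuityZ3.Theorems.HairyCycle

end
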